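import Literature.MathematicalPhysics.QuantumFieldTheory.Balaban1983to89.FlowStep
import Literature.MathematicalPhysics.QuantumFieldTheory.Balaban1983to89.B14FlowStep

/-!
# K1⁷ — NODE O's LETTER LADDER IN THE RUN CURRENCY, II: KERNEL SEPARATIONS of the rungs, each living inside a two-sided box of arbitrary radius

Cell `pub-ymgap`, WIDTH SEAT `pub-ymgap-dag-n24-w1` (gen 3; director-ym №197 ∕ HUMAN RULING D-0149).  `--kind proof --supports stmt-QuantumFields-20542 --as helper`
(count-neutral).  Key of record: K1⁷ `Summit.QuantumFields.YangMills.Theses.BalabanUVNodes.StabilityBAtRecordR13SepCoPH` (skeleton v6 03f66ac9cc89391f, plan g82).  Sibling module (I, the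
EDGES PS floor ⟹ no-shrink, the bounded-lag payment of the box floor): `…Theorems.BalabanUVNodesK1NodeOLadderRunwiseEdges` (not imported — this module is self-contained over `FlowStep`).
[I] = [Balaban1987RG1] CMP **109** (1987): (0.20) p.256, Thm 2 p.259, §1 p.264, (5.10) p.293; [III] = [Balaban1988Convergent] CMP **119** (1988): (2.6) p.255 («β₀ > 0 can be chosen
arbitrarily small»).

THE LADDER (run currency `RGEqH n β gs ∧ Step.InInterval γ n gs`, [I] (0.20)): SIGN `BetaLowerH 0 γ β` (dag-n24-c 33H) ⟹ PS FLOOR `−M ≤ ∑_{[k,n)} β` (32H `hps`; K1⁷ v6 stub 2″ row (iv))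
⟹ NO-HALVING `g_m ≤ (1+1)·g_{n′}` (36H `hnh`; (2.6)'s last member at `β₀ = 1`) ⟹ NO-SHRINK `g_m ≤ (1+β₀)·g_{n′}` for SOME `β₀ > 0` (ym-nodeO-ideate P3 g52 n°90 `hnsF`; the weakest
floor-side letter `WorldP` carries).  K0⁷'s registered stub 3ᴬ′ supplies, independently, a SIGN-FREE two-sided box `−β′ ≤ β ≤ β′` on `]0, γ]`.  P3 marked the strictness of the two bottom
edges «informal model, not kernel-checked» (n°89 `RunwiseMulFloor` docstring; n°90 (v)); `psFloor_not_sign` is P3 n°89 :231 (memo, kernel).  THIS FILE makes every edge STRICT BY A KERNEL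
WITNESS THAT LIVES INSIDE THE BOX `[−β′, 0]` FOR AN ARBITRARY PRESCRIBED RADIUS `β′ > 0` (hence inside every door's box, §0 `betaBoxH_mono`, P3 g52 R-28) — so K0⁷'s sign-free box can neither pay nor collapse any rung, and each of the
four tree currencies asks NODE O for genuinely more than the next.

WHAT IS HERE (generic `β : HBeta`; letters UNFOLDED to the VERBATIM shapes of 32H `hps` ∕ 36H `hnh`; NO definition): §0 `betaBoxH_mono` (reading the box conjunct); (a) ★ `absBox_not_noShrink` — box ⇏ no-shrink for ANY slack `β₀` on
ANY window (model `β ≡ −β′`: along the run from `g_0 = γ`, `1/g_n² = 1/γ² + nβ′` is unbounded; the box pays NO floor-side letter — flow-currency relatives: strat-b14 `printed_hyps_fail_26d_27a`,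
`B16PerBareCounter`); (b) ★★ `absBox_noShrink_not_noShrink_of_lt` — for slacks `0 ≤ β₀ < β₁`: no-(1+β₁)⁻¹-shrink on EVERY window, no-(1+β₀)⁻¹-shrink on NONE; instances (b₁) `absBox_noShrinkThird_not_noHalving`
(n°90's ∃β₀ rung STRICTLY below 36H's no-halving) and (b₂) `absBox_noHalving_not_noShrinkHalf` (36H's no-halving STRICTLY below no-shrink at slack `1/2` — the largest slack strat-b14's
`B14FlowStep.SmallnessFor` AS RECORDED admits: §0 `smallnessFor_slack_le_half` ∕ `not_smallnessFor_slack_one` read its fields `2 ≤ L`, `h29c : L·β₀ ≤ 1`; v1.1 CAVEAT: `h29c` is a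
SUFFICIENT, NON-SHARP restriction — strat-b14's `third_member_29_sharp` needs only `L·β₀·γ²β′ ≤ 1`, so the SHARP printed cap on the slack is `β₀ ≤ 1` ((2.7), `ineq27a`), at which the
no-halving worlds of 29H∕30H∕32H∕36H sit exactly; either way the slack N11 accepts is CAPPED, so an ∃-slack NODE-O letter carries a MATCH against it unless paid in the β₀-UNIFORM PS-floor
currency of the registered row (iv)); (c) ★★
`absBox_noHalving_not_psFloor` — no-halving on EVERY window, the PS floor for NO `M` on ANY window (36H's letter STRICTLY below 32H's ∕ the registered row (iv)); (d) `absBox_psFloor_not_sign`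
(P3 :231 PORTED WITH ATTRIBUTION, scaled into the box: PS floor `M := β′` on every window, the sign on none).  Models for (b)(c): the HISTORY-DEPENDENT two-phase family
`β_k(g_0,…,g_k) := −β′` while `1/g_k² + β′ ≤ (1+c)/g_0²`, `0` afterwards (`1 + c = (1+β₁)²` ∕ `c = 3`): along EVERY (0.20)-run the invariant `1/g_0² ≤ 1/g_k² ≤ (1+c)/g_0²` holds (the negative phase
stops exactly when the next step would leave the band), so the coupling never drops below `(1+c)^{−1/2}` of any earlier value; while the explicit run `g_k = (1/x² + β′k)^{−1/2}` started at
`g_0 = x → 0⁺` stays in the negative phase for `⌊c/(β′x²)⌋` steps and accumulates the additive drawdown `> c/x² − β′`.  Private lemmas: the explicit run (`sqrtRun_*`, `constModel_run`,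
`twoPhase_run`), the model's box membership, invariant and no-shrink (`twoPhase_box ∕ _invariant ∕ _noShrink`).

REVISIONS.  v1 p611396.  v1.1 (this edition; DOC-ONLY — no declaration added, removed or changed): the §0 ∕ (b₂) prose no longer calls the slack-`1/2` cap «the printed regime»: it is the
cap of strat-b14's `SmallnessFor` AS RECORDED (`h29c : L·β₀ ≤ 1`, flagged there as sufficient-not-sharp, `third_member_29_sharp`); the sharp printed cap is `β₀ ≤ 1` (bus ERRATUM-1 l.30808).

HONEST FRAMING.  Explicit elementary counter-models for IMPLICATIONS BETWEEN HYPOTHESIS SHAPES; nothing of Bałaban asserted, nothing about `Node00.betaOfRecord₁₃` proved or refuted (which rung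
the true β of record satisfies is NODE O's unprinted content, [I] Thm 2 p.259 ∕ T09.F — the model β's here are NOT claimed to resemble it); NO stub closed; K0⁷ ∕ K1⁷ OPEN; N24 COMPOSITE — no
discharge, counts unmoved (typed 28∕28 · discharged 5∕27); one finite 𝕋⁴ programme at fixed `ε = L^{−K}`, Bałaban AS PRINTED; route R4 closes ONLY the CONDITIONAL finite-𝕋⁴ rung
`BalabanLadder.UV` — the Yang–Mills mass gap (Clay) is NOT proved by any of this; nothing continuum ∕ ℝ⁴ ∕ OS.  Theorems only: no `def`, no `instance`, no `sorry`, standard axioms;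
imports `Literature…FlowStep` and `Literature…B14FlowStep` only (Theses-free).
-/

noncomputable section

namespace Summit.QuantumFields.YangMills.Theorems.K1NodeOLadderRunwiseSeparations

open Literature.MathematicalPhysics.QuantumFieldTheory.Balaban1983to89
open FlowStep (HBeta RGEqH prefixOf prefixOf_apply BetaLowerH BetaUpperH Box mem_box inv_sq_telescopeH)

variable {β : HBeta}

/-! ## §0. Reading the box conjunct: every witness below has `−β′ ≤ β ≤ 0`, hence lies in EVERY two-sided box `[bₗ, βup]` with `bₗ ≤ −β′`, `0 ≤ βup` -/

/-- Box bounds are monotone in the bounds: `BetaLowerH b ∧ BetaUpperH u` with `b' ≤ b`, `u ≤ u'` gives `BetaLowerH b' ∧ BetaUpperH u'` (so the witnesses below, stated with the box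
`[−β′, 0]` for an ARBITRARY `β′ > 0`, sit inside K0⁷'s 3ᴬ′ box as every N24 door reads it — `hl : −bₗ·γ² ≤ 3`, `hβ′ : βup·γ² ≤ 3/4` — on taking `β′ ≤ 3/γ²`; ym-nodeO-ideate P3 g52 R-28).
[cite: Balaban1987RG1, §1 p.264 (bookkeeping)] -/
theorem betaBoxH_mono {b b' u u' γ : ℝ} (hb : b' ≤ b) (hu : u ≤ u') (h : BetaLowerH b γ β ∧ BetaUpperH u γ β) :
    BetaLowerH b' γ β ∧ BetaUpperH u' γ β :=
  ⟨fun k v hv => hb.trans (h.1 k v hv), fun k v hv => (h.2 k v hv).trans hu⟩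

/-- **WHICH SLACK strat-b14's RECORDED SMALLNESS ALLOWS**: the structure `B14FlowStep.SmallnessFor` (its fields `hL : 2 ≤ L` and `h29c : L·β₀ ≤ 1`, the latter a SUFFICIENT, NON-SHARP
reading of (2.9)'s third member — v1.1 caveat: the sharp requirement is `L·β₀·γ²β′ ≤ 1`, `B14FlowStep.third_member_29_sharp`, under which every `β₀ ≤ 1` is admissible for small `γ`; the
sharp printed cap is (2.7)'s `β₀ ≤ 1`, field `β₀_le_one`) forces `β₀ ≤ 1/2` — so every consumer of (2.6)–(2.9) THROUGH `SmallnessFor` (`flowControl_of_betaSign ∕ _of_partialSum ∕ _of_avgAF …`)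
works at a slack `≤ 1/2`, where the floor-side letter NODE O owes (no-(1+β₀)⁻¹-shrink with `β₀ ≤ 1/2`) is STRICTLY above 36H's no-halving (`absBox_noHalving_not_noShrinkHalf` below) but still
paid by the PS floor for EVERY `β₀ > 0` (sibling module `exists_noShrink_of_psFloor`): the registered row (iv) is the β₀-UNIFORM (match-free) floor currency, an ∃β₀ no-shrink letter carries a
floor-side MATCH against the (capped) slack N11 accepts. [cite: Balaban1988Convergent, (2.6)–(2.9) pp.255–256 («β₀ > 0 can be chosen arbitrarily small»)] -/
theorem smallnessFor_slack_le_half {γ β' β₀ : ℝ} {L p : ℕ} (S : B14FlowStep.SmallnessFor γ β' β₀ L p) : β₀ ≤ 1 / 2 := by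
  have hL : (2 : ℝ) ≤ L := by exact_mod_cast S.hL
  nlinarith [S.h29c, S.β₀_pos]

/-- … in particular the no-halving instance `β₀ = 1` (the world built by 29H ∕ 30H ∕ 32H ∕ 36H) is OUTSIDE `SmallnessFor` AS RECORDED for every `γ, β′, L, p` (v1.1 caveat: NOT outside the
sharp printed regime — `β₀ = 1` is exactly (2.7)'s cap `β₀ ≤ 1` and passes `third_member_29_sharp` for small `γ`; a road for N11 at slack `1` must bypass `h29c`). [cite: Balaban1988Convergent, (2.9) p.256 (bookkeeping)] -/
theorem not_smallnessFor_slack_one {γ β' : ℝ} {L p : ℕ} : ¬ B14FlowStep.SmallnessFor γ β' 1 L p :=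
  fun S => by have h := smallnessFor_slack_le_half S; norm_num at h

/-! ## §1. The explicit run and the two model families -/

section Models

/-- The explicit decreasing run `g_k := (1/x² + β′k)^{−1/2}`: positivity. [folklore] -/
private theorem sqrtRun_pos {A β' : ℝ} (hA : 0 < A) (hβ' : 0 ≤ β') (k : ℕ) : 0 < (Real.sqrt (A + β' * k))⁻¹ :=
  inv_pos.mpr (Real.sqrt_pos.mpr (by positivity))

/-- … it never exceeds its initial value `(√A)⁻¹`. [folklore] -/
private theorem sqrtRun_le {A β' : ℝ} (hA : 0 < A) (hβ' : 0 ≤ β') (k : ℕ) : (Real.sqrt (A + β' * k))⁻¹ ≤ (Real.sqrt A)⁻¹ :=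
  inv_anti₀ (Real.sqrt_pos.mpr hA) (Real.sqrt_le_sqrt (by nlinarith [mul_nonneg hβ' (Nat.cast_nonneg k)]))

/-- … and `1/g_k² = A + β′k`. [folklore] -/
private theorem sqrtRun_inv_sq {A β' : ℝ} (hA : 0 < A) (hβ' : 0 ≤ β') (k : ℕ) : 1 / ((Real.sqrt (A + β' * k))⁻¹) ^ 2 = A + β' * k := by
  rw [inv_pow, one_div, inv_inv, Real.sq_sqrt (by positivity)]

/-- … equivalently `g_k² = 1/(A + β′k)`. [folklore] -/
private theorem sqrtRun_sq {A β' : ℝ} (hA : 0 < A) (hβ' : 0 ≤ β') (k : ℕ) : ((Real.sqrt (A + β' * k))⁻¹) ^ 2 = 1 / (A + β' * k) := by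
  rw [inv_pow, Real.sq_sqrt (by positivity), one_div]

/-- `(√(1/x²))⁻¹ = x` for `x > 0`. [folklore] -/
private theorem sqrt_one_div_sq_inv {x : ℝ} (hx : 0 < x) : (Real.sqrt (1 / x ^ 2))⁻¹ = x := by
  rw [one_div, Real.sqrt_inv, inv_inv, Real.sqrt_sq hx.le]

/-- Squaring a comparison of the endpoints of the explicit run started at `x`: `g_0 ≤ L·g_n` forces `1/x² + β′n ≤ L²/x²`. [folklore] -/
private theorem sqrtRun_ratio {x β' L : ℝ} (hx : 0 < x) (hβ' : 0 ≤ β') {n : ℕ}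
    (h : (Real.sqrt (1 / x ^ 2 + β' * ((0 : ℕ) : ℝ)))⁻¹ ≤ L * (Real.sqrt (1 / x ^ 2 + β' * (n : ℝ)))⁻¹) :
    1 / x ^ 2 + β' * n ≤ L ^ 2 * (1 / x ^ 2) := by
  have hA : 0 < 1 / x ^ 2 := by positivity
  have h0 : 0 < (Real.sqrt (1 / x ^ 2 + β' * ((0 : ℕ) : ℝ)))⁻¹ := sqrtRun_pos hA hβ' 0
  have hsq := pow_le_pow_left₀ h0.le h 2
  rw [mul_pow, sqrtRun_sq hA hβ' 0, sqrtRun_sq hA hβ' n] at hsq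
  simp only [Nat.cast_zero, mul_zero, add_zero] at hsq
  have hB : 0 < 1 / x ^ 2 + β' * n := by positivity
  rw [← div_eq_mul_one_div, div_le_div_iff₀ hA hB, one_mul] at hsq
  linarith

/-- The constant family `β ≡ −β′` admits the explicit decreasing run `g_k = (1/x² + β′k)^{−1/2}` in `]0, x]` up to EVERY `n`. [folklore] -/
private theorem constModel_run {β' : ℝ} (hβ' : 0 ≤ β') {x : ℝ} (hx : 0 < x) (n : ℕ) :
    RGEqH n (fun _ _ => -β') (fun k => (Real.sqrt (1 / x ^ 2 + β' * k))⁻¹) ∧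
      Step.InInterval x n (fun k => (Real.sqrt (1 / x ^ 2 + β' * k))⁻¹) := by
  have hA : 0 < 1 / x ^ 2 := by positivity
  refine ⟨fun k _ => ?_, fun k _ => ⟨sqrtRun_pos hA hβ' k, (sqrtRun_le hA hβ' k).trans (sqrt_one_div_sq_inv hx).le⟩⟩
  show 1 / ((Real.sqrt (1 / x ^ 2 + β' * (k : ℕ)))⁻¹) ^ 2 = 1 / ((Real.sqrt (1 / x ^ 2 + β' * ((k + 1 : ℕ) : ℝ)))⁻¹) ^ 2 + -β'
  rw [sqrtRun_inv_sq hA hβ' k, sqrtRun_inv_sq hA hβ' (k + 1)]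
  push_cast; ring

/-- The two-phase history model `β_k(v) := −β′` while `1/v_k² + β′ ≤ (1+c)/v_0²`, else `0`, lives in the box `[−β′, 0]`. [folklore] -/
private theorem twoPhase_box {β' c : ℝ} (hβ' : 0 ≤ β')
    (hβ : ∀ (k : ℕ) (v : Fin (k + 1) → ℝ), β k v = if 1 / (v (Fin.last k)) ^ 2 + β' ≤ (1 + c) * (1 / (v 0) ^ 2) then -β' else 0) (γ : ℝ) :
    BetaLowerH (-β') γ β ∧ BetaUpperH 0 γ β := by
  refine ⟨fun k v _ => ?_, fun k v _ => ?_⟩ <;> rw [hβ k v] <;> split_ifs <;> linarith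

/-- The two-phase model's INVARIANT along every (0.20)-run: `1/g_0² ≤ 1/g_k² ≤ (1+c)/g_0²` for `k ≤ n` (the negative phase stops exactly when the next step would leave the band). [folklore] -/
private theorem twoPhase_invariant {β' c : ℝ} (hβ' : 0 ≤ β') (hc : 0 ≤ c)
    (hβ : ∀ (k : ℕ) (v : Fin (k + 1) → ℝ), β k v = if 1 / (v (Fin.last k)) ^ 2 + β' ≤ (1 + c) * (1 / (v 0) ^ 2) then -β' else 0)
    {n : ℕ} {gs : ℕ → ℝ} (hrg : RGEqH n β gs) :
    ∀ k, k ≤ n → 1 / (gs 0) ^ 2 ≤ 1 / (gs k) ^ 2 ∧ 1 / (gs k) ^ 2 ≤ (1 + c) * (1 / (gs 0) ^ 2) := by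
  intro k
  induction k with
  | zero =>
    intro _
    exact ⟨le_rfl, le_mul_of_one_le_left (one_div_nonneg.mpr (sq_nonneg _)) (by linarith)⟩
  | succ k ih =>
    intro hk
    obtain ⟨ihlo, ihhi⟩ := ih (Nat.le_of_succ_le hk)
    have hstep := hrg k (Nat.lt_of_succ_le hk)
    rw [hβ k] at hstep
    simp only [prefixOf_apply, Fin.val_last, Fin.val_zero] at hstep
    split_ifs at hstep with hcond
    · constructor <;> linarith
    · constructor <;> linarith

/-- The two-phase model is NO-(1+β₀)⁻¹-SHRINK on EVERY window as soon as `1 + c ≤ (1+β₀)²`. [folklore] -/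
private theorem twoPhase_noShrink {β' c β₀ : ℝ} (hβ' : 0 ≤ β') (hc : 0 ≤ c) (hβ₀ : 0 ≤ 1 + β₀) (hcβ : 1 + c ≤ (1 + β₀) ^ 2)
    (hβ : ∀ (k : ℕ) (v : Fin (k + 1) → ℝ), β k v = if 1 / (v (Fin.last k)) ^ 2 + β' ≤ (1 + c) * (1 / (v 0) ^ 2) then -β' else 0) (γ : ℝ) :
    ∀ (n : ℕ) (gs : ℕ → ℝ), RGEqH n β gs → Step.InInterval γ n gs → ∀ m n', m < n' → n' ≤ n → gs m ≤ (1 + β₀) * gs n' := by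
  intro n gs hrg hI m n' hmn hn'
  have hm : 0 < gs m := (hI m (hmn.le.trans hn')).1
  have hn : 0 < gs n' := (hI n' hn').1
  obtain ⟨hmlo, -⟩ := twoPhase_invariant hβ' hc hβ hrg m (hmn.le.trans hn')
  obtain ⟨-, hnhi⟩ := twoPhase_invariant hβ' hc hβ hrg n' hn'
  have key : 1 / (gs n') ^ 2 ≤ (1 + β₀) ^ 2 * (1 / (gs m) ^ 2) :=
    calc 1 / (gs n') ^ 2 ≤ (1 + c) * (1 / (gs 0) ^ 2) := hnhi
      _ ≤ (1 + c) * (1 / (gs m) ^ 2) := mul_le_mul_of_nonneg_left hmlo (by linarith)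
      _ ≤ (1 + β₀) ^ 2 * (1 / (gs m) ^ 2) := mul_le_mul_of_nonneg_right hcβ (by positivity)
  have hm2 : 0 < (gs m) ^ 2 := by positivity
  have hn2 : 0 < (gs n') ^ 2 := by positivity
  have hsq : (gs m) ^ 2 ≤ ((1 + β₀) * gs n') ^ 2 := by
    rw [div_le_iff₀ hn2] at key
    have e : (1 + β₀) ^ 2 * (1 / (gs m) ^ 2) * (gs n') ^ 2 = (1 + β₀) ^ 2 * (gs n') ^ 2 / (gs m) ^ 2 := by ring
    rw [e, le_div_iff₀ hm2] at key
    rw [mul_pow]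
    linarith
  exact (pow_le_pow_iff_left₀ hm.le (mul_nonneg hβ₀ hn.le) two_ne_zero).1 hsq

/-- The two-phase model ADMITS the explicit decreasing run `g_k = (1/x² + β′k)^{−1/2}`, `k ≤ n`, as a (0.20)-solution in `]0, x]` whenever `n·β′ ≤ c/x²` (the whole run is in the negative
phase). [folklore] -/
private theorem twoPhase_run {β' c : ℝ} (hβ' : 0 ≤ β')
    (hβ : ∀ (k : ℕ) (v : Fin (k + 1) → ℝ), β k v = if 1 / (v (Fin.last k)) ^ 2 + β' ≤ (1 + c) * (1 / (v 0) ^ 2) then -β' else 0)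
    {x : ℝ} (hx : 0 < x) {n : ℕ} (hn : (n : ℝ) * β' ≤ c * (1 / x ^ 2)) :
    RGEqH n β (fun k => (Real.sqrt (1 / x ^ 2 + β' * k))⁻¹) ∧ Step.InInterval x n (fun k => (Real.sqrt (1 / x ^ 2 + β' * k))⁻¹) := by
  have hA : 0 < 1 / x ^ 2 := by positivity
  refine ⟨fun k hk => ?_, fun k _ => ⟨sqrtRun_pos hA hβ' k, (sqrtRun_le hA hβ' k).trans (sqrt_one_div_sq_inv hx).le⟩⟩
  have hk1 : ((k : ℝ) + 1) * β' ≤ (n : ℝ) * β' := mul_le_mul_of_nonneg_right (by exact_mod_cast hk) hβ'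
  have hcond : 1 / (prefixOf (fun k : ℕ => (Real.sqrt (1 / x ^ 2 + β' * k))⁻¹) k (Fin.last k)) ^ 2 + β' ≤
      (1 + c) * (1 / (prefixOf (fun k : ℕ => (Real.sqrt (1 / x ^ 2 + β' * k))⁻¹) k 0) ^ 2) := by
    simp only [prefixOf_apply, Fin.val_last, Fin.val_zero]
    rw [sqrtRun_inv_sq hA hβ' k, sqrtRun_inv_sq hA hβ' 0]
    simp only [Nat.cast_zero, mul_zero, add_zero]
    linarith
  rw [hβ k, if_pos hcond]
  show 1 / ((Real.sqrt (1 / x ^ 2 + β' * (k : ℕ)))⁻¹) ^ 2 = 1 / ((Real.sqrt (1 / x ^ 2 + β' * ((k + 1 : ℕ) : ℝ)))⁻¹) ^ 2 + -β'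
  rw [sqrtRun_inv_sq hA hβ' k, sqrtRun_inv_sq hA hβ' (k + 1)]
  push_cast; ring

end Models

/-! ## §2. The separations -/

/-- **★ (a) THE BOX PAYS NO FLOOR-SIDE LETTER**: for every radius `β′ > 0` the constant family `β ≡ −β′` lies in the box `[−β′, 0]` on every window and is no-(1+β₀)⁻¹-shrink for NO slack
`β₀` on NO window `]0, γ]` (along the run from `g_0 = γ`, `1/g_k² = 1/γ² + kβ′` is unbounded).  So K0⁷'s sign-free box (stub 3ᴬ′) does NOT make 36H's `hnhF` ∕ n°90's `hnsF` idle: NODE O's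
K1 letter is genuinely owed.  (Flow-currency relatives: strat-b14 `printed_hyps_fail_26d_27a`, `B16PerBareCounter`.) [cite: Balaban1988Convergent, (2.6) p.255; Balaban1987RG1, (0.20) p.256, Thm 2 p.259 (elementary model)] -/
theorem absBox_not_noShrink {β' : ℝ} (hβ' : 0 < β') : ∃ β : HBeta,
    (∀ γ : ℝ, BetaLowerH (-β') γ β ∧ BetaUpperH 0 γ β) ∧
      ∀ γ : ℝ, 0 < γ → ∀ β₀ : ℝ,
        ¬ ∀ (n : ℕ) (gs : ℕ → ℝ), RGEqH n β gs → Step.InInterval γ n gs → ∀ m n', m < n' → n' ≤ n → gs m ≤ (1 + β₀) * gs n' := by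
  refine ⟨fun _ _ => -β', fun γ => ⟨fun _ _ _ => le_rfl, fun _ _ _ => by linarith⟩, fun γ hγ β₀ hns => ?_⟩
  have hA : 0 < 1 / γ ^ 2 := by positivity
  -- the run from `g_0 = γ`, `n := ⌊(1+β₀)²/(γ²β′)⌋ + 1` steps: `1/g_n² = 1/γ² + nβ′ > (1+β₀)²/γ²`
  obtain ⟨hrg, hI⟩ := constModel_run hβ'.le hγ (⌊(1 + β₀) ^ 2 * (1 / γ ^ 2) / β'⌋₊ + 1)
  have hnβ : (1 + β₀) ^ 2 * (1 / γ ^ 2) < ((⌊(1 + β₀) ^ 2 * (1 / γ ^ 2) / β'⌋₊ + 1 : ℕ) : ℝ) * β' := by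
    have := Nat.lt_floor_add_one ((1 + β₀) ^ 2 * (1 / γ ^ 2) / β')
    rw [div_lt_iff₀ hβ'] at this
    push_cast
    linarith
  have h := hns _ _ hrg hI 0 (⌊(1 + β₀) ^ 2 * (1 / γ ^ 2) / β'⌋₊ + 1) (Nat.succ_pos _) le_rfl
  have key := sqrtRun_ratio hγ hβ'.le h
  push_cast at key hnβ
  linarith

/-- **★★ (b) NO-SHRINK IS STRICTLY MONOTONE IN THE SLACK, INSIDE THE BOX**: for every radius `β′ > 0` and slacks `0 ≤ β₀ < β₁`, the two-phase history family with `1 + c = (1+β₁)²` lies in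
`[−β′, 0]`, is no-(1+β₁)⁻¹-shrink on EVERY window and no-(1+β₀)⁻¹-shrink on NO window (the run from `g_0 = x`, `x ≤ min(γ, 1, ((1+β₁)²−(1+β₀)²)/β′)`, reaches `1/g_n² > (1+β₀)²/g_0²`).
Instances: (b₁) n°90's ∃β₀ rung (slack 2, say) is STRICTLY below 36H's no-halving; (b₂) 36H's no-halving is STRICTLY below the slack-`1/2` letter (the cap of `SmallnessFor` as recorded, §0).
[cite: Balaban1988Convergent, (2.6) p.255 («β₀ > 0 can be chosen arbitrarily small»); Balaban1987RG1, (0.20) p.256 (elementary model)] -/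
theorem absBox_noShrink_not_noShrink_of_lt {β' β₀ β₁ : ℝ} (hβ' : 0 < β') (hβ₀ : 0 ≤ β₀) (hlt : β₀ < β₁) : ∃ β : HBeta,
    (∀ γ : ℝ, BetaLowerH (-β') γ β ∧ BetaUpperH 0 γ β) ∧
      (∀ (γ : ℝ) (n : ℕ) (gs : ℕ → ℝ), RGEqH n β gs → Step.InInterval γ n gs → ∀ m n', m < n' → n' ≤ n → gs m ≤ (1 + β₁) * gs n') ∧
        ∀ γ : ℝ, 0 < γ →
          ¬ ∀ (n : ℕ) (gs : ℕ → ℝ), RGEqH n β gs → Step.InInterval γ n gs → ∀ m n', m < n' → n' ≤ n → gs m ≤ (1 + β₀) * gs n' := by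
  set c : ℝ := (1 + β₁) ^ 2 - 1 with hc_def
  set δ : ℝ := (1 + β₁) ^ 2 - (1 + β₀) ^ 2 with hδ_def
  have hδ : 0 < δ := by rw [hδ_def]; nlinarith
  have hδc : δ ≤ c := by rw [hδ_def, hc_def]; nlinarith
  have hc : 0 ≤ c := hδ.le.trans hδc
  refine ⟨fun k v => if 1 / (v (Fin.last k)) ^ 2 + β' ≤ (1 + c) * (1 / (v 0) ^ 2) then -β' else 0,
    twoPhase_box hβ'.le (fun _ _ => rfl),
    fun γ => twoPhase_noShrink hβ'.le hc (by linarith) (by rw [hc_def]; linarith) (fun _ _ => rfl) γ, fun γ hγ hns => ?_⟩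
  -- the run from `x := min γ (min 1 (δ/β'))`, so that `δ·(1/x²) ≥ β'`
  set x : ℝ := min γ (min 1 (δ / β')) with hx_def
  have hx : 0 < x := lt_min hγ (lt_min one_pos (div_pos hδ hβ'))
  have hxγ : x ≤ γ := min_le_left _ _
  have hx1 : x ≤ 1 := (min_le_right _ _).trans (min_le_left _ _)
  have hxδ : x ≤ δ / β' := (min_le_right _ _).trans (min_le_right _ _)
  have hA : 0 < 1 / x ^ 2 := by positivity
  have hxA : 1 / x ≤ 1 / x ^ 2 := one_div_le_one_div_of_le (by positivity) (by nlinarith)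
  have hβA : β' ≤ δ * (1 / x ^ 2) := by
    have h1 : 1 / (δ / β') ≤ 1 / x := one_div_le_one_div_of_le hx hxδ
    rw [one_div_div] at h1
    have h2 : β' / δ ≤ 1 / x ^ 2 := h1.trans hxA
    rw [div_le_iff₀ hδ] at h2
    linarith
  set n : ℕ := ⌊c * (1 / x ^ 2) / β'⌋₊ with hn_def
  have hnle : (n : ℝ) * β' ≤ c * (1 / x ^ 2) := by
    have := Nat.floor_le (show 0 ≤ c * (1 / x ^ 2) / β' by positivity)
    rw [le_div_iff₀ hβ'] at this
    exact this
  have hngt : c * (1 / x ^ 2) - β' < (n : ℝ) * β' := by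
    have := Nat.lt_floor_add_one (c * (1 / x ^ 2) / β')
    rw [div_lt_iff₀ hβ'] at this
    simp only [hn_def]; linarith
  have hδcA : δ * (1 / x ^ 2) ≤ c * (1 / x ^ 2) := mul_le_mul_of_nonneg_right hδc hA.le
  have hn1 : 0 < n := by
    have h1 : (1 : ℝ) ≤ c * (1 / x ^ 2) / β' := by
      rw [le_div_iff₀ hβ', one_mul]
      exact hβA.trans hδcA
    have := Nat.le_floor (α := ℝ) (n := 1) (by exact_mod_cast h1)
    simp only [hn_def]; omega
  obtain ⟨hrg, hI⟩ := twoPhase_run (c := c) hβ'.le (fun _ _ => rfl) hx hnle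
  have hIγ : Step.InInterval γ n (fun k => (Real.sqrt (1 / x ^ 2 + β' * k))⁻¹) := fun k hk => ⟨(hI k hk).1, (hI k hk).2.trans hxγ⟩
  have h := hns n _ hrg hIγ 0 n hn1 le_rfl
  have key := sqrtRun_ratio hx hβ'.le h
  have hcd : c * (1 / x ^ 2) - δ * (1 / x ^ 2) = (1 + β₀) ^ 2 * (1 / x ^ 2) - 1 / x ^ 2 := by
    rw [hc_def, hδ_def]; ring
  linarith

/-- **(b₁) n°90's ∃-SLACK NO-SHRINK IS STRICTLY BELOW 36H's NO-HALVING, inside the box**: slack `2` on every window (`gs m ≤ (1 + 2) * gs n'`), slack `1` on none.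
[cite: Balaban1988Convergent, (2.6) p.255; Balaban1987RG1, (0.20) p.256 (elementary model)] -/
theorem absBox_noShrinkThird_not_noHalving {β' : ℝ} (hβ' : 0 < β') : ∃ β : HBeta,
    (∀ γ : ℝ, BetaLowerH (-β') γ β ∧ BetaUpperH 0 γ β) ∧
      (∀ (γ : ℝ) (n : ℕ) (gs : ℕ → ℝ), RGEqH n β gs → Step.InInterval γ n gs → ∀ m n', m < n' → n' ≤ n → gs m ≤ (1 + 2) * gs n') ∧
        ∀ γ : ℝ, 0 < γ →
          ¬ ∀ (n : ℕ) (gs : ℕ → ℝ), RGEqH n β gs → Step.InInterval γ n gs → ∀ m n', m < n' → n' ≤ n → gs m ≤ (1 + 1) * gs n' :=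
  absBox_noShrink_not_noShrink_of_lt hβ' zero_le_one one_lt_two

/-- **(b₂) 36H's NO-HALVING IS STRICTLY BELOW THE SLACK-½ LETTER (the cap of `SmallnessFor` as recorded), inside the box**: no-halving (`gs m ≤ (1 + 1) * gs n'`, 36H's `hnh` VERBATIM) on every window, no-⅔-shrink
(`gs m ≤ (1 + 1/2) * gs n'`, the largest slack `SmallnessFor` as recorded admits, §0) on none. [cite: Balaban1988Convergent, (2.6)–(2.9) pp.255–256; Balaban1987RG1, (0.20) p.256 (elementary model)] -/
theorem absBox_noHalving_not_noShrinkHalf {β' : ℝ} (hβ' : 0 < β') : ∃ β : HBeta,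
    (∀ γ : ℝ, BetaLowerH (-β') γ β ∧ BetaUpperH 0 γ β) ∧
      (∀ (γ : ℝ) (n : ℕ) (gs : ℕ → ℝ), RGEqH n β gs → Step.InInterval γ n gs → ∀ m n', m < n' → n' ≤ n → gs m ≤ (1 + 1) * gs n') ∧
        ∀ γ : ℝ, 0 < γ →
          ¬ ∀ (n : ℕ) (gs : ℕ → ℝ), RGEqH n β gs → Step.InInterval γ n gs → ∀ m n', m < n' → n' ≤ n → gs m ≤ (1 + 1 / 2) * gs n' :=
  absBox_noShrink_not_noShrink_of_lt hβ' (by norm_num) (by norm_num)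

/-- **★★ (c) NO-HALVING IS STRICTLY BELOW THE PARTIAL-SUM FLOOR, INSIDE THE BOX**: for every `β′ > 0` the two-phase history family with `c = 3` lies in `[−β′, 0]`, is NO-HALVING on EVERY
window (36H's `hnh` letter, `gs m ≤ (1 + 1) * gs n'`), and satisfies the run-wise PS floor (32H's `hps` ∕ K1⁷ v6 row (iv)) for NO `M` on NO window (the run from `g_0 = x → 0⁺` accumulates
`−∑_{[0,n)} β = n·β′ > 3/x² − β′`).  So 32H's road (and the registered stub 2″ text) asks NODE O for STRICTLY MORE than 36H's, even given K0's box. [cite: Balaban1988Convergent, (2.6) p.255; Balaban1987RG1, (0.20) p.256, Thm 2 p.259, (5.10) p.293 (elementary model)] -/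
theorem absBox_noHalving_not_psFloor {β' : ℝ} (hβ' : 0 < β') : ∃ β : HBeta,
    (∀ γ : ℝ, BetaLowerH (-β') γ β ∧ BetaUpperH 0 γ β) ∧
      (∀ (γ : ℝ) (n : ℕ) (gs : ℕ → ℝ), RGEqH n β gs → Step.InInterval γ n gs → ∀ m n', m < n' → n' ≤ n → gs m ≤ (1 + 1) * gs n') ∧
        ∀ γ : ℝ, 0 < γ → ∀ M : ℝ,
          ¬ ∀ (n : ℕ) (gs : ℕ → ℝ), RGEqH n β gs → Step.InInterval γ n gs → ∀ k, k ≤ n → -M ≤ ∑ j ∈ Finset.Ico k n, β j (prefixOf gs j) := by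
  refine ⟨fun k v => if 1 / (v (Fin.last k)) ^ 2 + β' ≤ (1 + 3) * (1 / (v 0) ^ 2) then -β' else 0,
    twoPhase_box hβ'.le (fun _ _ => rfl), fun γ => twoPhase_noShrink hβ'.le (by norm_num) (by norm_num) (by norm_num) (fun _ _ => rfl) γ,
    fun γ hγ M hps => ?_⟩
  -- the run from `x := min γ (min 1 (min (1/β') (1/(|M|+1))))`, so that `A := 1/x² ≥ max (β', |M|+1)`
  set x : ℝ := min γ (min 1 (min (1 / β') (1 / (|M| + 1)))) with hx_def
  have hM1 : 0 < |M| + 1 := by positivity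
  have hx : 0 < x := lt_min hγ (lt_min one_pos (lt_min (by positivity) (by positivity)))
  have hxγ : x ≤ γ := min_le_left _ _
  have hx1 : x ≤ 1 := (min_le_right _ _).trans (min_le_left _ _)
  have hxβ : x ≤ 1 / β' := ((min_le_right _ _).trans (min_le_right _ _)).trans (min_le_left _ _)
  have hxM : x ≤ 1 / (|M| + 1) := ((min_le_right _ _).trans (min_le_right _ _)).trans (min_le_right _ _)
  set A : ℝ := 1 / x ^ 2 with hA_def
  have hA : 0 < A := by positivity
  have hxA : 1 / x ≤ A := by
    rw [hA_def]; exact one_div_le_one_div_of_le (by positivity) (by nlinarith)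
  have hβA : β' ≤ A := by
    have : 1 / (1 / β') ≤ 1 / x := one_div_le_one_div_of_le hx hxβ
    rw [one_div_one_div] at this
    exact this.trans hxA
  have hMA : |M| + 1 ≤ A := by
    have : 1 / (1 / (|M| + 1)) ≤ 1 / x := one_div_le_one_div_of_le hx hxM
    rw [one_div_one_div] at this
    exact this.trans hxA
  set n : ℕ := ⌊3 * A / β'⌋₊ with hn_def
  have hnle : (n : ℝ) * β' ≤ 3 * (1 / x ^ 2) := by
    have := Nat.floor_le (show 0 ≤ 3 * A / β' by positivity)
    rw [le_div_iff₀ hβ'] at this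
    exact this
  have hngt : 3 * A - β' < (n : ℝ) * β' := by
    have := Nat.lt_floor_add_one (3 * A / β')
    rw [div_lt_iff₀ hβ'] at this
    simp only [hn_def]; linarith
  obtain ⟨hrg, hI⟩ := twoPhase_run (c := 3) hβ'.le (fun _ _ => rfl) hx hnle
  have hIγ : Step.InInterval γ n (fun k => (Real.sqrt (1 / x ^ 2 + β' * k))⁻¹) := fun k hk => ⟨(hI k hk).1, (hI k hk).2.trans hxγ⟩
  have h := hps n _ hrg hIγ 0 (Nat.zero_le _)
  have htel := inv_sq_telescopeH hrg (Nat.zero_le n) le_rfl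
  rw [sqrtRun_inv_sq hA hβ'.le 0, sqrtRun_inv_sq hA hβ'.le n] at htel
  simp only [Nat.cast_zero, mul_zero, add_zero] at htel
  have hsum : ∑ j ∈ Finset.Ico 0 n, (fun (k : ℕ) (v : Fin (k + 1) → ℝ) => if 1 / (v (Fin.last k)) ^ 2 + β' ≤ (1 + 3) * (1 / (v 0) ^ 2) then -β' else 0) j
      (prefixOf (fun k => (Real.sqrt (1 / x ^ 2 + β' * (k : ℝ)))⁻¹) j) = -((n : ℝ) * β') := by linarith
  rw [hsum] at h
  have : M ≤ |M| := le_abs_self M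
  linarith

/-- **(d) THE PARTIAL-SUM FLOOR IS STRICTLY BELOW THE SIGN, INSIDE THE BOX** (ym-nodeO-ideate P3 g52 n°89 `psFloor_not_sign` (:231), PORTED WITH ATTRIBUTION and scaled into the box): for every
`β′ > 0`, `β_0 := −β′`, `β_k := 0` (`k ≥ 1`) lies in `[−β′, 0]`, has the run-wise PS floor `M := β′` on EVERY window and the sign `BetaLowerH 0 γ β` on NONE. [cite: Balaban1987RG1, Thm 2 p.259 (first sentence), (0.20) p.256 (elementary model)] -/
theorem absBox_psFloor_not_sign {β' : ℝ} (hβ' : 0 < β') : ∃ β : HBeta,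
    (∀ γ : ℝ, BetaLowerH (-β') γ β ∧ BetaUpperH 0 γ β) ∧
      (∀ (γ : ℝ) (n : ℕ) (gs : ℕ → ℝ), RGEqH n β gs → Step.InInterval γ n gs → ∀ k, k ≤ n → -β' ≤ ∑ j ∈ Finset.Ico k n, β j (prefixOf gs j)) ∧
        ∀ γ : ℝ, 0 < γ → ¬ BetaLowerH 0 γ β := by
  refine ⟨fun k _ => if k = 0 then -β' else 0, fun γ => ⟨fun k v _ => ?_, fun k v _ => ?_⟩, fun γ n gs _ _ k _ => ?_, fun γ hγ hlo => ?_⟩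
  · show -β' ≤ (if k = 0 then -β' else 0)
    split_ifs <;> linarith
  · show (if k = 0 then -β' else 0) ≤ 0
    split_ifs <;> linarith
  · simp only [Finset.sum_ite_eq', Finset.mem_Ico]
    split_ifs <;> linarith
  · have hv : (fun _ : Fin (0 + 1) => γ) ∈ Box γ 0 := mem_box.mpr fun _ => ⟨hγ, le_rfl⟩
    have h1 := hlo 0 _ hv
    norm_num at h1
    linarith

end Summit.QuantumFields.YangMills.Theorems.K1NodeOLadderRunwiseSeparations

end
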